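import Summits.QuantumFields.YangMills.Theorems.BalabanLadderUVSeamRecCeilingsWindowCellLawsThreshold
import Summits.QuantumFields.YangMills.Theorems.BalabanLadderUVSeamRecClassicalResponseGlue
import HarnessLib

/-!
# Crux `UVSeamRec` (stmt-QuantumFields-20043), v5(α) stub `stub_responseMomentsOdd6` (RM): the v6(β-cl) glue with the large-field half
# re-keyed SEAM-AWARE — (split-cl) + (GD) + WINDOW CELL LAWS ⇒ `ResponseMomentsOdd6SU2`

Helper file (`--supports stmt-QuantumFields-20043`) of the width-lever seat `ym-20043-ceilings-p2` (lane B, gen 3); a twin of the LEAD's v6(β-cl)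
glue p548409 `ClassicalResponse.responseMomentsOdd6SU2_of_backgroundField_and_gaussianDomination` in which the large-field input is NOT the
doubled joint exponential moment (EM_I) over ALL cube families (`ClassicalResponse.EMI`, seam-exposed: on tori with `b^k ∤ 2L+1` it is not
suppliable from single-scale product laws with uniform constants for NON-reduced representatives, note LANE-B-g3 §7) but the lane-B supplier
target of record candidate: the WINDOW CELL LAWS at the levels `k ≥ 1` with summable sixteenth roots, plus a threshold floor `ε(β,0) ≥ ε₀ > 0` at
level `0` (PROVED there).  Composition: the LEAD's constants (`C := max C_s (4v₁+1)`, `splitCl_rescale`, `emLin_rescale`, Hubbard–Stratonovich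
`emQ_of_subGaussianLinear`) for the quadratic carrier `carrierCl C 1`, then this seat's `responseMoments_of_quadratic_and_windowCellLaws_floor`
(seam reduction + sign classes + levelwise Hölder + proved level `0`).

* `responseMomentsOdd6SU2_of_splitCl_gaussianDomination_windowCellLaws` — hypotheses: tempering data and constants with `SplitCl` (LEAD's
  (split-cl), p548409), `GaussianDominationSU2` (LEAD's (GD)), `0 < ε₀ ≤ ε β 0`, window cell laws `hWCL` (k ≥ 1, activities `δ ≤ θ^16`,
  `θ ∈ [0,1]`) and `Σ_{1≤k≤kmax β R} θ β k ≤ D`; conclusion: `ResponseMomentsDefs.ResponseMomentsOdd6SU2` (the registered stub body, by name).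
So a v6/v7 along (β-cl) may register THREE non-fed stubs {(split-cl), (GD), (WCL)} — the third being lane B's — and close
`stub_responseMomentsOdd6` by `exact responseMomentsOdd6SU2_of_splitCl_gaussianDomination_windowCellLaws …`.  HONEST FRAMING: composition;
all three inputs are OPEN renormalisation-group statements; nothing of E0′; not a gap, not Clay.
References: folklore.
-/

set_option autoImplicit false

noncomputable section

open MeasureTheory Filter Topology Finset
open Literature.Probability.LatticeModels
open Literature.MathematicalPhysics.QuantumFieldTheory (GaugeConfig LatticeRep)
open Literature.MathematicalPhysics.QuantumLattice
open Summit.QuantumFields.YangMills.Cruxes.OSLegsFromFemtoAndGap.DlrCollarTransfer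
open Summit.QuantumFields.YangMills.Cruxes.UVSeamRec.ClassicalResponse
open Summit.QuantumFields.YangMills.Cruxes.UVSeamRec.PolymerData
open Summit.QuantumFields.YangMills.Theorems.OddTorusChessboard (Orient)

namespace Summit.QuantumFields.YangMills.Cruxes.UVSeamRec.TemperedResponse

/-- **THE SEAM-AWARE v6(β-cl) GLUE: (split-cl) + (GD) + WINDOW CELL LAWS ⇒ the registered stub body `ResponseMomentsOdd6SU2`.**  Tempering data
`𝔟, ε, kmax`, constants `C_s > 0`, `C₁ > 0`, `A₀ ≥ 0`, `ℓ₁ > 0`, bounded reference values `p`, with the LEAD's (split-cl) `SplitCl 𝔟 ε kmax C_s C₁ A₀ β₁ ℓ₁ p`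
and (GD) `GaussianDominationSU2`; a level-`0` threshold floor `0 < ε₀ ≤ ε β 0`; and lane B's WINDOW CELL LAWS: weights `θ β k ∈ [0,1]`, activities
`0 ≤ δ β k ≤ (θ β k)^16`, for `β ≥ β₁`, `L ≥ 1`, `k ≥ 1`, every window origin `o` and every finite family `A` of level-`k` block-plaquettes whose footprints
fit in `[o, o+2L+1)⁴`: `⟨∏_{γ∈A} 1_{largeFieldEvent 𝔟 (ε β k) γ}∘lift⟩_{2L+1,β} ≤ ∏_{γ∈A} δ β k`, with `Σ_{1≤k≤kmax β R} θ β k ≤ D` (`β ≥ β₁`).  THEN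
`ResponseMomentsOdd6SU2`. [folklore] -/
theorem responseMomentsOdd6SU2_of_splitCl_gaussianDomination_windowCellLaws
    (𝔟 : BlockSize) (ε : ℝ → ℕ → ℝ) (kmax : ℝ → ℕ → ℕ) {C_s C₁ A₀ P₀ β₁ ℓ₁ D ε₀ : ℝ} {p : Fin 4 × Fin 4 → ℝ → ℝ}
    (hCs : 0 < C_s) (hC₁ : 0 < C₁) (hA₀ : 0 ≤ A₀) (hℓ₁ : 0 < ℓ₁) (hp : ∀ q β, |p q β| ≤ P₀)
    (hsplit : SplitCl 𝔟 ε kmax C_s C₁ A₀ β₁ ℓ₁ p) (hGD : GaussianDominationSU2)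
    (hε₀ : 0 < ε₀) (hε : ∀ β, ε₀ ≤ ε β 0)
    (θ δ : ℝ → ℕ → ℝ) (hθ0 : ∀ β k, 0 ≤ θ β k) (hθ1 : ∀ β k, θ β k ≤ 1) (hδ0 : ∀ β k, 0 ≤ δ β k)
    (hδθ : ∀ β k, δ β k ≤ θ β k ^ 16)
    (hWCL : ∀ β : ℝ, β₁ ≤ β → ∀ L : ℕ, 1 ≤ L → ∀ k : ℕ, 1 ≤ k → ∀ (o : Fin 4 → ℤ) (A : Finset Polymer),
      (∀ γ ∈ A, γ.k = k) → (∀ γ ∈ A, ∀ c, o c ≤ anchor 𝔟 γ c ∧ anchor 𝔟 γ c + (𝔟.b : ℤ) ^ k ≤ o c + (2 * L + 1)) →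
      torusE (Matrix.specialUnitaryGroup (Fin 2) ℂ) (fundamentalLatticeRep 2) β L (fun U => ∏ γ ∈ A,
        (largeFieldEvent (N := 2) 𝔟 (ε β k) γ).indicator (fun _ => (1 : ℝ)) U) ≤ ∏ _γ ∈ A, δ β k)
    (hD : ∀ β : ℝ, β₁ ≤ β → ∀ R : ℕ, ∑ k ∈ (Finset.range (kmax β R + 1)).filter (fun k => 1 ≤ k), θ β k ≤ D) :
    ResponseMomentsDefs.ResponseMomentsOdd6SU2 := by
  obtain ⟨m₁, v₁, β₁', ℓ₁', hℓ₁', hEM⟩ := hGD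
  -- constants (as in the LEAD's glue)
  set C : ℝ := max C_s (4 * v₁ + 1) with hCdef
  have hCsC : C_s ≤ C := le_max_left _ _
  have hCpos : 0 < C := hCs.trans_le hCsC
  have h4v : 4 * (v₁ / C) < 1 := by
    rw [mul_div_assoc', div_lt_one hCpos]
    have : 4 * v₁ + 1 ≤ C := le_max_right _ _
    linarith
  set β₀ : ℝ := max (max β₁ β₁') 0 with hβ₀
  have hβ₀₁ : β₁ ≤ β₀ := (le_max_left _ _).trans (le_max_left _ _)
  have hβ₀₁' : β₁' ≤ β₀ := (le_max_right _ _).trans (le_max_left _ _)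
  have hβ₀0 : 0 ≤ β₀ := le_max_right _ _
  set ℓ₀ : ℝ := min ℓ₁ ℓ₁' with hℓ₀
  have hℓ₀pos : 0 < ℓ₀ := lt_min hℓ₁ hℓ₁'
  set rF : LatticeRep (Matrix.specialUnitaryGroup (Fin 2) ℂ) := fundamentalLatticeRep 2 with hrF
  -- rescaled laws
  have hsplitC := splitCl_rescale hCs hCsC hA₀ hsplit
  have hEMC := emLin_rescale hCpos hEM
  -- the quadratic carrier and its linear statistic
  set Q : ℝ → ℕ → Fin 4 × Fin 4 → (Fin 4 → ℤ) → LGConfig 4 (Matrix.specialUnitaryGroup (Fin 2) ℂ) → ℝ :=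
    fun β R q x η => carrierCl rF C 1 β R q x η with hQdef
  set ℓ : ℝ → ℕ → Fin 4 × Fin 4 → (Fin 4 → ℤ) → LGConfig 4 (Matrix.specialUnitaryGroup (Fin 2) ℂ) → ℝ :=
    fun β R q x η => Real.sqrt (carrierCl rF C 1 β R q x η) with hℓdef
  have hℓm : ∀ β R q x, Measurable (ℓ β R q x) := fun β R q x => (measurable_carrierCl (r := rF) C 1 β R q x).sqrt
  have hℓb : ∀ β R q x η, |ℓ β R q x η| ≤ Real.sqrt (|β| * (R : ℝ) ^ 4 / |C| * (2 * rF.N)) := fun β R q x η => by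
    simp only [hℓdef]
    rw [abs_of_nonneg (Real.sqrt_nonneg _)]
    exact Real.sqrt_le_sqrt ((le_abs_self _).trans (abs_carrierCl_le (r := rF) C one_pos β R q x η))
  -- (EM_Q) for `1·ℓ²` from the rescaled (EM_lin), restricted to β ≥ β₀ and R·uRec β ≤ ℓ₀
  have hEMQ1 := emQ_of_subGaussianLinear rF Transport.uRec (β₁ := β₀) (ℓ₁ := ℓ₀) ℓ
    (fun β R => Real.sqrt (|β| * (R : ℝ) ^ 4 / |C| * (2 * rF.N))) hℓm hℓb (m := m₁ / Real.sqrt C) (v := v₁ / C) (lam := 1)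
    zero_le_one (by linarith)
    (fun β hβ L n q x R hq hR hRa hL hsep T t =>
      hEMC β (hβ₀₁'.trans hβ) L n q x R hq hR (hRa.trans (min_le_right _ _)) hL hsep T t)
  -- convert `1·(√Q)²` to `Q` (β ≥ β₀ ≥ 0)
  have hEMQ : ∀ β : ℝ, β₀ ≤ β → ∀ (L n : ℕ) (q : Fin n → Fin 4 × Fin 4) (x : Fin n → (Fin 4 → ℤ)) (R : ℕ),
      (∀ i, (q i).1 < (q i).2) → 1 ≤ R → (R : ℝ) * Transport.uRec β ≤ ℓ₀ → 4 * R + 8 ≤ L →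
      (∀ i j : Fin n, i ≠ j → ∃ k : Fin 4,
        (2 * (R : ℤ) + 4) ≤ |((((x i k - x j k : ℤ) : ZMod (2 * L + 1))).valMinAbs : ℤ)|) →
      ∀ T : Finset (Fin n),
        torusE (Matrix.specialUnitaryGroup (Fin 2) ℂ) rF β L
          (fun U => Real.exp (((2 : ℕ) : ℝ) * ∑ i ∈ T, Q β R (q i) (x i) U)) ≤
          Real.exp (Real.log (2 * (Real.sqrt (1 / (1 - 4 * (1 * (v₁ / C)))) *
            Real.exp (2 * 1 * (m₁ / Real.sqrt C) ^ 2 / (1 - 4 * (1 * (v₁ / C)))))) * T.card) := by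
    intro β hβ L n q x R hq hR hRa hL hsep T
    have h := hEMQ1 β hβ L n q x R hq hR hRa hL hsep T
    have e : (fun U : LGConfig 4 (Matrix.specialUnitaryGroup (Fin 2) ℂ) =>
        Real.exp (((2 : ℕ) : ℝ) * ∑ i ∈ T, Q β R (q i) (x i) U)) =
        (fun U => Real.exp (((2 : ℕ) : ℝ) * ∑ i ∈ T, 1 * (ℓ β R (q i) (x i) U) ^ 2)) := by
      funext U
      refine congrArg Real.exp (congrArg _ (Finset.sum_congr rfl fun i _ => ?_))
      simp only [hQdef, hℓdef]
      rw [one_mul, Real.sq_sqrt (carrierCl_nonneg (r := rF) hCpos one_pos (hβ₀0.trans hβ) R (q i) (x i) U)]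
    rw [e]
    exact h
  -- (RM) body from the seam-aware window-cell-law button (threshold floor at level 0, Δ₀ := 1)
  obtain ⟨β₁'', hRM⟩ := responseMoments_of_quadratic_and_windowCellLaws_floor (N := 2) Transport.uRec 𝔟 ε kmax
    (C₁ := C₁ * C / C_s) (β₁ := β₀) (ℓ₁ := ℓ₀) (A₀ := A₀) (D := D) (Δ₀ := 1) (ε₀ := ε₀) (p := p) hε₀ hε one_pos Q
    (fun β R _ _ => |β| * (R : ℝ) ^ 4 / |C| * (2 * rF.N))
    (fun β R q x => measurable_carrierCl (r := rF) C 1 β R q x)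
    (fun β R q x η => abs_carrierCl_le (r := rF) C one_pos β R q x η)
    (fun β hβ R hR hRa q x hq η => hsplitC β (hβ₀₁.trans hβ) R hR (hRa.trans (min_le_left _ _)) q x hq η)
    hEMQ θ δ hθ0 hθ1 hδ0 hδθ
    (fun β hβ L hL k hk o A hAk hwin => hWCL β (hβ₀₁.trans hβ) L hL k hk o A hAk hwin)
    (fun β hβ R => hD β (hβ₀₁.trans hβ) R)
  exact ⟨Transport.uRec, 1, C₁ * C / C_s, _, β₁'', ℓ₀, P₀, p, one_pos,
    Filter.Eventually.of_forall fun β => by rw [one_mul], hℓ₀pos, by positivity, hp, hRM⟩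

end Summit.QuantumFields.YangMills.Cruxes.UVSeamRec.TemperedResponse

end
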